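import Mathlib
import Summits.MatrixMultiplication.MatrixMultiplication.Theorems.SnSubsetDichotomyHyperoctahedralThresholdStubCycleGadget
import Summits.MatrixMultiplication.MatrixMultiplication.Theorems.SnSubsetDichotomyHyperoctahedralThresholdStubPathGadget
import Summits.MatrixMultiplication.MatrixMultiplication.Theorems.SnSubsetDichotomyHyperoctahedralThresholdStubMobiusGadget
import Summits.MatrixMultiplication.MatrixMultiplication.Theorems.SnSubsetDichotomyHyperoctahedralThresholdStubExtract

/-!
# `SnSubsetDichotomy.HyperoctahedralThreshold`, line `one-scale-dichotomy` — stub `stub_assembly`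

One-scale greedy packing of clean closed rung-walks into support-disjoint commuting local triples
(crux `stmt-MatrixMultiplication-10883`, registered stub `stub_assembly` of the lead's skeleton
for line `one-scale-dichotomy`).

Setting: `μ 0, μ 1, μ 2` are fixed-point-free involutions of `Fin n`.  A member `w = (col, p, q)`
of the family `W` is a closed colour-walk of `k + 2` rungs indexed cyclically by `Fin (k + 2)`:
`p i ≠ q i`, the colour `col i` maps `{p i, q i}` onto `{p (i + 1), q (i + 1)}` (sides preserved
or swapped), cyclically consecutive colours differ, and two rungs are equal as sets or disjoint.
Every point of `Fin n` lies on at most `D` members of `W`, and `|W| > 2 (k + 2) · D · G`.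

Conclusion: `G` commuting local triples — commuting involutions `a j, b j`, not both `1`, with
`a j ∈ C(μ 0)`, `b j ∈ C(μ 1)`, `a j * b j ∈ C(μ 2)` — with pairwise disjoint supports.

Proof.
* `OneScaleAssembly.select`: greedy induction on `G`.  The point set of a member (the images of
  `p` and `q`) has at most `2 (k + 2)` points (`card_pts_le`); the members meeting a set `U` of
  points number at most `|U| · D` (`card_meeting_le`); so once `G` members are chosen, at most
  `2 (k + 2) · D · G < |W|` members meet their points, and a further member whose point set is
  disjoint from all of theirs exists (prepended with `Fin.cons`).
* `OneScaleAssembly.gadget_of_clean`: one clean closed rung-walk carries a commuting local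
  triple supported on its points: `stub_extract` yields a clean cycle, a clean loop-path-loop or
  a clean Möbius cycle on points of the walk, and `stub_cycleGadget` / `stub_pathGadget` /
  `stub_mobiusGadget` turn that shape into the triple.
* `stub_assembly`: choose a triple along every selected member; a point moved by triple `j` lies
  among the points of member `j`, hence not among those of member `j' ≠ j`, hence is fixed by
  triple `j'`.
-/

-- the tree's namespace `Summit.MatrixMultiplication.MatrixMultiplication.…` repeats a component by design
set_option linter.dupNamespace false

namespace Summit.MatrixMultiplication.MatrixMultiplication.Theorems.HyperoctahedralThreshold

open Equiv

namespace OneScaleAssembly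

variable {n k : ℕ}

/-- Membership in the point set `im p ∪ im q` of a rung-walk `w = (col, p, q)`. [folklore] -/
theorem mem_pts (w : (Fin (k + 2) → Fin 3) × (Fin (k + 2) → Fin n) × (Fin (k + 2) → Fin n))
    (v : Fin n) :
    v ∈ Finset.univ.image w.2.1 ∪ Finset.univ.image w.2.2 ↔ ∃ i, w.2.1 i = v ∨ w.2.2 i = v := by
  simp only [Finset.mem_union, Finset.mem_image, Finset.mem_univ, true_and]
  constructor
  · rintro (⟨i, hi⟩ | ⟨i, hi⟩)
    · exact ⟨i, Or.inl hi⟩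
    · exact ⟨i, Or.inr hi⟩
  · rintro ⟨i, hi | hi⟩
    · exact Or.inl ⟨i, hi⟩
    · exact Or.inr ⟨i, hi⟩

/-- The point set of a rung-walk with `k + 2` rungs has at most `2 (k + 2)` points. [folklore] -/
theorem card_pts_le (w : (Fin (k + 2) → Fin 3) × (Fin (k + 2) → Fin n) × (Fin (k + 2) → Fin n)) :
    (Finset.univ.image w.2.1 ∪ Finset.univ.image w.2.2).card ≤ 2 * (k + 2) := by
  have h1 : (Finset.univ.image w.2.1).card ≤ k + 2 := by
    simpa using (Finset.card_image_le (s := (Finset.univ : Finset (Fin (k + 2)))) (f := w.2.1))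
  have h2 : (Finset.univ.image w.2.2).card ≤ k + 2 := by
    simpa using (Finset.card_image_le (s := (Finset.univ : Finset (Fin (k + 2)))) (f := w.2.2))
  calc (Finset.univ.image w.2.1 ∪ Finset.univ.image w.2.2).card
      ≤ (Finset.univ.image w.2.1).card + (Finset.univ.image w.2.2).card := Finset.card_union_le _ _
    _ ≤ (k + 2) + (k + 2) := Nat.add_le_add h1 h2
    _ = 2 * (k + 2) := by ring

/-- Members meeting a point set `U` number at most `|U| · D` when every point lies on at most `D`
members. [folklore] -/
theorem card_meeting_le {D : ℕ}
    (W : Finset ((Fin (k + 2) → Fin 3) × (Fin (k + 2) → Fin n) × (Fin (k + 2) → Fin n)))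
    (hdeg : ∀ v : Fin n, (W.filter (fun w => ∃ i, w.2.1 i = v ∨ w.2.2 i = v)).card ≤ D)
    (U : Finset (Fin n)) :
    (W.filter (fun w => ∃ v ∈ U, ∃ i, w.2.1 i = v ∨ w.2.2 i = v)).card ≤ U.card * D := by
  classical
  calc (W.filter (fun w => ∃ v ∈ U, ∃ i, w.2.1 i = v ∨ w.2.2 i = v)).card
      ≤ (U.biUnion (fun v => W.filter (fun w => ∃ i, w.2.1 i = v ∨ w.2.2 i = v))).card := by
        apply Finset.card_le_card
        intro w hw
        simp only [Finset.mem_filter] at hw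
        obtain ⟨hwW, v, hvU, hi⟩ := hw
        exact Finset.mem_biUnion.2 ⟨v, hvU, Finset.mem_filter.2 ⟨hwW, hi⟩⟩
    _ ≤ ∑ v ∈ U, (W.filter (fun w => ∃ i, w.2.1 i = v ∨ w.2.2 i = v)).card :=
        Finset.card_biUnion_le
    _ ≤ ∑ _v ∈ U, D := Finset.sum_le_sum (fun v _ => hdeg v)
    _ = U.card * D := by rw [Finset.sum_const, smul_eq_mul]

/-- **Greedy selection**: if every point lies on at most `D` members of `W` and
`2 (k + 2) · D · G < |W|`, then `W` has `G` members with pairwise disjoint point sets.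
[folklore] -/
theorem select {D : ℕ}
    (W : Finset ((Fin (k + 2) → Fin 3) × (Fin (k + 2) → Fin n) × (Fin (k + 2) → Fin n)))
    (hdeg : ∀ v : Fin n, (W.filter (fun w => ∃ i, w.2.1 i = v ∨ w.2.2 i = v)).card ≤ D) :
    ∀ G : ℕ, 2 * (k + 2) * D * G < W.card →
      ∃ ws : Fin G → (Fin (k + 2) → Fin 3) × (Fin (k + 2) → Fin n) × (Fin (k + 2) → Fin n),
        (∀ j, ws j ∈ W) ∧
        (∀ j j', j ≠ j' →
          Disjoint (Finset.univ.image (ws j).2.1 ∪ Finset.univ.image (ws j).2.2)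
            (Finset.univ.image (ws j').2.1 ∪ Finset.univ.image (ws j').2.2)) := by
  intro G
  induction G with
  | zero => intro _; exact ⟨Fin.elim0, fun j => j.elim0, fun j => j.elim0⟩
  | succ G ih =>
    intro hbig
    classical
    obtain ⟨ws, hws, hdisj⟩ := ih (lt_of_le_of_lt (Nat.mul_le_mul_left _ (Nat.le_succ G)) hbig)
    -- the points used so far
    set U : Finset (Fin n) :=
      Finset.univ.biUnion (fun j => Finset.univ.image (ws j).2.1 ∪ Finset.univ.image (ws j).2.2)
      with hU
    have hUcard : U.card ≤ G * (2 * (k + 2)) := by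
      calc U.card ≤ ∑ j, (Finset.univ.image (ws j).2.1 ∪ Finset.univ.image (ws j).2.2).card :=
            Finset.card_biUnion_le
        _ ≤ ∑ _j : Fin G, 2 * (k + 2) := Finset.sum_le_sum (fun j _ => card_pts_le (ws j))
        _ = G * (2 * (k + 2)) := by simp
    -- fewer than `|W|` members meet `U`
    have hlt : (W.filter (fun w => ∃ v ∈ U, ∃ i, w.2.1 i = v ∨ w.2.2 i = v)).card < W.card := by
      calc (W.filter (fun w => ∃ v ∈ U, ∃ i, w.2.1 i = v ∨ w.2.2 i = v)).card ≤ U.card * D :=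
            card_meeting_le W hdeg U
        _ ≤ G * (2 * (k + 2)) * D := Nat.mul_le_mul_right _ hUcard
        _ = 2 * (k + 2) * D * G := by ring
        _ < W.card := by
            rcases Nat.eq_zero_or_pos D with hD0 | hDpos
            · subst hD0
              simpa using hbig
            · have : 1 ≤ 2 * (k + 2) * D := Nat.one_le_iff_ne_zero.2 (by positivity)
              have e : 2 * (k + 2) * D * (G + 1) = 2 * (k + 2) * D * G + 2 * (k + 2) * D := by
                ring
              omega
    -- a member of `W` meeting no point of `U`
    have hex : ∃ w ∈ W, ∀ v ∈ U, ¬ ∃ i, w.2.1 i = v ∨ w.2.2 i = v := by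
      by_contra hcon
      push Not at hcon
      apply lt_irrefl W.card
      calc W.card ≤ (W.filter (fun w => ∃ v ∈ U, ∃ i, w.2.1 i = v ∨ w.2.2 i = v)).card := by
            apply Finset.card_le_card
            intro w hw
            obtain ⟨v, hvU, i, hi⟩ := hcon w hw
            exact Finset.mem_filter.2 ⟨hw, v, hvU, i, hi⟩
        _ < W.card := hlt
    obtain ⟨w, hwW, hwU⟩ := hex
    have hnew : ∀ j, Disjoint (Finset.univ.image w.2.1 ∪ Finset.univ.image w.2.2)
        (Finset.univ.image (ws j).2.1 ∪ Finset.univ.image (ws j).2.2) := by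
      intro j
      rw [Finset.disjoint_left]
      intro v hv hv'
      have hvU : v ∈ U := Finset.mem_biUnion.2 ⟨j, Finset.mem_univ _, hv'⟩
      exact hwU v hvU ((mem_pts w v).1 hv)
    refine ⟨Fin.cons w ws, ?_, ?_⟩
    · intro j
      refine Fin.cases ?_ (fun j => ?_) j
      · simpa only [Fin.cons_zero] using hwW
      · simpa only [Fin.cons_succ] using hws j
    · intro j j'
      refine Fin.cases ?_ (fun i => ?_) j
      · refine Fin.cases (fun h => absurd rfl h) (fun i' _ => ?_) j'
        simpa only [Fin.cons_zero, Fin.cons_succ] using hnew i'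
      · refine Fin.cases (fun _ => ?_) (fun i' h => ?_) j'
        · simpa only [Fin.cons_zero, Fin.cons_succ] using (hnew i).symm
        · have hii' : i ≠ i' := fun e => h (by rw [e])
          simpa only [Fin.cons_succ] using hdisj i i' hii'

/-- Points of extracted data lie among the walk's points. [folklore] -/
theorem among_pts {m m' : ℕ} (p q : Fin m → Fin n) (p' q' : Fin m' → Fin n)
    (h : ∀ i, (∃ j, p' i = p j ∨ p' i = q j) ∧ (∃ j, q' i = p j ∨ q' i = q j)) (v : Fin n)
    (hv : ∃ i, v = p' i ∨ v = q' i) : ∃ j, p j = v ∨ q j = v := by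
  obtain ⟨i, hi⟩ := hv
  rcases hi with rfl | rfl
  · obtain ⟨j, hj | hj⟩ := (h i).1
    · exact ⟨j, Or.inl hj.symm⟩
    · exact ⟨j, Or.inr hj.symm⟩
  · obtain ⟨j, hj | hj⟩ := (h i).2
    · exact ⟨j, Or.inl hj.symm⟩
    · exact ⟨j, Or.inr hj.symm⟩

/-- A clean closed rung-walk carries a commuting local triple supported on its points (tree
theorems `stub_extract` and `stub_cycleGadget` / `stub_pathGadget` / `stub_mobiusGadget`).
[folklore] -/
theorem gadget_of_clean (μ : Fin 3 → Equiv.Perm (Fin n)) (hinv : ∀ c, μ c * μ c = 1)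
    (hfpf : ∀ c v, μ c v ≠ v)
    (w : (Fin (k + 2) → Fin 3) × (Fin (k + 2) → Fin n) × (Fin (k + 2) → Fin n))
    (hw : (∀ i, w.2.1 i ≠ w.2.2 i) ∧
      (∀ i, (μ (w.1 i) (w.2.1 i) = w.2.1 (i + 1) ∧ μ (w.1 i) (w.2.2 i) = w.2.2 (i + 1)) ∨
        (μ (w.1 i) (w.2.1 i) = w.2.2 (i + 1) ∧ μ (w.1 i) (w.2.2 i) = w.2.1 (i + 1))) ∧
      (∀ i, w.1 i ≠ w.1 (i + 1)) ∧
      (∀ i j, (w.2.1 i = w.2.1 j ∧ w.2.2 i = w.2.2 j) ∨ (w.2.1 i = w.2.2 j ∧ w.2.2 i = w.2.1 j) ∨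
        (w.2.1 i ≠ w.2.1 j ∧ w.2.1 i ≠ w.2.2 j ∧ w.2.2 i ≠ w.2.1 j ∧ w.2.2 i ≠ w.2.2 j))) :
    ∃ a b : Equiv.Perm (Fin n), (a * a = 1 ∧ b * b = 1 ∧ a * b = b * a ∧ (a ≠ 1 ∨ b ≠ 1) ∧
      a * μ 0 = μ 0 * a ∧ b * μ 1 = μ 1 * b ∧ a * b * μ 2 = μ 2 * (a * b)) ∧
      ∀ v, (a v ≠ v ∨ b v ≠ v) → v ∈ Finset.univ.image w.2.1 ∪ Finset.univ.image w.2.2 := by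
  obtain ⟨hpq, hstep, hcol, heod⟩ := hw
  rcases stub_extract n (k + 1) μ w.2.1 w.2.2 w.1 hinv hfpf hpq hstep hcol heod with
    ⟨k', p', q', col', hp, hq, hpq', hstep', hcol', hamong, -⟩ |
    ⟨k', p', q', col', hp, hq, hpq', h0, hlast, hstep', hcol', hamong, -⟩ |
    ⟨k', p', q', col', hp, hq, hpq', hstep', hwp, hwq, hcol', hwrap, hamong, -⟩
  · obtain ⟨a, b, h1, h2, h3, h4, h5, h6, h7, hsupp⟩ :=
      stub_cycleGadget n k' μ p' q' col' hinv hp hq hpq' hstep' hcol'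
    exact ⟨a, b, ⟨h1, h2, h3, h4, h5, h6, h7⟩,
      fun v hv => (mem_pts w v).2 (among_pts w.2.1 w.2.2 p' q' hamong v (hsupp v hv))⟩
  · obtain ⟨a, b, h1, h2, h3, h4, h5, h6, h7, hsupp⟩ :=
      stub_pathGadget n k' μ p' q' col' hinv hp hq hpq' h0 hlast hstep' hcol'
    exact ⟨a, b, ⟨h1, h2, h3, h4, h5, h6, h7⟩,
      fun v hv => (mem_pts w v).2 (among_pts w.2.1 w.2.2 p' q' hamong v (hsupp v hv))⟩
  · obtain ⟨a, b, h1, h2, h3, h4, h5, h6, h7, hsupp⟩ :=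
      stub_mobiusGadget n k' μ p' q' col' hinv hp hq hpq' hstep' hwp hwq hcol' hwrap
    exact ⟨a, b, ⟨h1, h2, h3, h4, h5, h6, h7⟩,
      fun v hv => (mem_pts w v).2 (among_pts w.2.1 w.2.2 p' q' hamong v (hsupp v hv))⟩

end OneScaleAssembly

open OneScaleAssembly in
/-- **One-scale packing** (stub `stub_assembly` of line `one-scale-dichotomy`, crux
`stmt-MatrixMultiplication-10883`): a family `W` of clean closed rung-walks with `k + 2` rungs
under the fixed-point-free involutions `μ 0, μ 1, μ 2`, in which every point lies on at most `D`
members and `|W| > 2 (k + 2) · D · G`, yields `G` commuting local triples (`a j ∈ C(μ 0)`,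
`b j ∈ C(μ 1)`, `a j * b j ∈ C(μ 2)`, commuting involutions, not both `1`) with pairwise disjoint
supports. -/
theorem stub_assembly : ∀ (n k G D : ℕ) (μ : Fin 3 → Equiv.Perm (Fin n)) (W : Finset ((Fin (k + 2) → Fin 3) × (Fin (k + 2) → Fin n) × (Fin (k + 2) → Fin n))), (∀ c, μ c * μ c = 1) → (∀ c v, μ c v ≠ v) → (∀ w ∈ W, (∀ i, w.2.1 i ≠ w.2.2 i) ∧ (∀ i, (μ (w.1 i) (w.2.1 i) = w.2.1 (i + 1) ∧ μ (w.1 i) (w.2.2 i) = w.2.2 (i + 1)) ∨ (μ (w.1 i) (w.2.1 i) = w.2.2 (i + 1) ∧ μ (w.1 i) (w.2.2 i) = w.2.1 (i + 1))) ∧ (∀ i, w.1 i ≠ w.1 (i + 1)) ∧ (∀ i j, (w.2.1 i = w.2.1 j ∧ w.2.2 i = w.2.2 j) ∨ (w.2.1 i = w.2.2 j ∧ w.2.2 i = w.2.1 j) ∨ (w.2.1 i ≠ w.2.1 j ∧ w.2.1 i ≠ w.2.2 j ∧ w.2.2 i ≠ w.2.1 j ∧ w.2.2 i ≠ w.2.2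 j))) → (∀ v : Fin n, (W.filter (fun w => ∃ i, w.2.1 i = v ∨ w.2.2 i = v)).card ≤ D) → 2 * (k + 2) * D * G < W.card → ∃ (a b : Fin G → Equiv.Perm (Fin n)), (∀ j, a j * a j = 1 ∧ b j * b j = 1 ∧ a j * b j = b j * a j ∧ (a j ≠ 1 ∨ b j ≠ 1) ∧ a j * μ 0 = μ 0 * a j ∧ b j * μ 1 = μ 1 * b j ∧ a j * b j * μ 2 = μ 2 * (a j * b j)) ∧ (∀ j j' : Fin G, j ≠ j' → ∀ v, (a j v ≠ v ∨ b j v ≠ v) → a j' v = v ∧ b j' v = v) := by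
  intro n k G D μ W hinv hfpf hW hdeg hbig
  obtain ⟨ws, hws, hdisj⟩ := select W hdeg G hbig
  have hg : ∀ j, ∃ a b : Equiv.Perm (Fin n), (a * a = 1 ∧ b * b = 1 ∧ a * b = b * a ∧
      (a ≠ 1 ∨ b ≠ 1) ∧ a * μ 0 = μ 0 * a ∧ b * μ 1 = μ 1 * b ∧ a * b * μ 2 = μ 2 * (a * b)) ∧
      ∀ v, (a v ≠ v ∨ b v ≠ v) → v ∈ Finset.univ.image (ws j).2.1 ∪ Finset.univ.image (ws j).2.2 :=
    fun j => gadget_of_clean μ hinv hfpf (ws j) (hW _ (hws j))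
  choose a b hab hsupp using hg
  refine ⟨a, b, hab, fun j j' hjj' v hv => ?_⟩
  have hvj : v ∈ Finset.univ.image (ws j).2.1 ∪ Finset.univ.image (ws j).2.2 := hsupp j v hv
  have hd := hdisj j j' hjj'
  constructor
  · by_contra h
    exact Finset.disjoint_left.1 hd hvj (hsupp j' v (Or.inl h))
  · by_contra h
    exact Finset.disjoint_left.1 hd hvj (hsupp j' v (Or.inr h))

end Summit.MatrixMultiplication.MatrixMultiplication.Theorems.HyperoctahedralThreshold
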